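import Summits.Langlands.Langlands.Theses.IrreducibilityBySelfDuality
import Literature.NumberTheory.GaloisRepresentations.PowLocallyAlgebraicProofs
import Literature.NumberTheory.GaloisRepresentations.AlgebraicHeckeCharacterGrossencharakterProofs
import Literature.NumberTheory.Automorphic.GLOneOfHeckeCharacterBJ
import Literature.NumberTheory.Automorphic.GLOneArchParameterOfAlgebraicCharacter
import HarnessLib

/-!
# `WeakAbelianSummandHecke` (route `IrreducibilityBySelfDuality`, item stmt-Langlands-13620), proved

The support item is Böckle–Hui 2025, Thm. 1.1 in its cofinite special case and in `GL(1)` language: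
for `K` any number field, `ρ : Γ_K → GL_n(ℚ̄_ℓ)` semisimple and `E`-rational (at almost every `v`:
unramified with Frobenius characteristic polynomial in `e(E[X])`), and a character
`ψ : Γ_K → GL_1(ℚ̄_ℓ)` with, at almost every `v`, `ρ`, `ψ` unramified and
`charpoly ψ(σ) ∣ charpoly ρ(σ)` at every arithmetic Frobenius `σ` over `v`, and for every field
isomorphism `ι : ℚ̄_ℓ ≃ ℂ`, there is a regular algebraic cuspidal `GL(1)` datum `χ` (Borel–Jacquet
model) with, almost everywhere, Satake parameter `{c_v}` and
`charpoly ψ(Frob_v) = arithFrobPolyOfSatake ι q_v 1 {c_v} = X - ι⁻¹(c_v⁻¹)`.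

## Proof (a dictionary exercise over PROVED tree results)

* a cofinite set of places has Dirichlet density one, so `ψ` weakly divides `ρ`
  (`FramedGaloisRep.WeaklyDivides.of_eventually`), and the hypothesis on `ρ` is literally
  `ρ.IsRationalOver e`;
* Böckle–Hui, Thm. 1.1 in the Hecke-character form of BH §3.2.1 is the named fact
  `exists_heckeCharacter_of_weaklyDivides`, DISCHARGED in the tree
  (`exists_heckeCharacter_of_weaklyDivides_holds`, `PowLocallyAlgebraicProofs`): it yields an
  algebraic Hecke character `θ` with `charpoly ψ(Frob_v) = X - ι⁻¹(θ(ϖ_v))⁻¹` a.e.;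
* the `GL(1)` dictionary (Borel–Jacquet 1979, 4.6): the line `ℂ · (θ ∘ det)` over `⊥` is a
  cuspidal datum `π_θ` (`exists_automorphicRepData_detTwist_glOne`; every automorphic form on
  `GL(1)` is a cusp form) with Hecke character `θ` (right translates of `θ ∘ det` are its
  multiples, `rightTranslation_detTwist_glOne`) and Satake parameter `{θ(ϖ_w)}` off a level of
  `θ` (`AutomorphicRepData.hasSatakeParamAt_detTwist_glOne`, `HeckeCharacter.exists_level_glOne`);
* Clozel's dictionary for `n = 1`: an infinity type `(p, q)` of `θ`
  (`HeckeCharacter.isAlgebraic_iff_exists_hasInfinityType`) makes `π_θ` regular algebraic — its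
  infinity type is `ι ↦ {(-n_ι, -n_ῑ)}`
  (`AutomorphicRepData.exists_hasInfinityType_of_hasInfinityType_heckeCharacter_glOne`), integral,
  and a singleton is regular;
* `arithFrobPolyOfSatake ι q 1 {c} = X - C (ι⁻¹ c⁻¹)` (`arithFrobPolyOfSatake_one`).

References: G. Böckle, C.-Y. Hui, Math. Ann. 393 (2025), Thm. 1.1 and §3.2.1 [BockleHui2025];
A. Borel, H. Jacquet, Corvallis 1979, 4.6 [BorelJacquetCorvallis1979]; L. Clozel, *Motifs et formes
automorphes* (1990), §1.1, Déf. 1.8, §3.3 [Clozel1990]; J.-P. Serre, *Abelian ℓ-adic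
representations* (1968), Ch. III [SerreAbelianLadic1968].
-/

noncomputable section

set_option linter.dupNamespace false -- project-wide option (lakefile weak.linter.dupNamespace); `Summit.Langlands.Langlands` is the mandated namespace

open scoped MatrixGroups Classical NumberField
open Filter IsDedekindDomain Polynomial
open Literature.NumberTheory.Automorphic Literature.NumberTheory.GaloisRepresentations

namespace Summit.Langlands.Langlands.Theorems.WeakAbelianSummandHecke

variable {K : Type} [Field K] [NumberField K]

/-- **The cuspidal `GL(1)` datum of a Hecke character, with its Hecke character and its Satake
parameters.**  For a Hecke character `θ` of `K`, the line `ℂ · (θ ∘ det)` over `⊥`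
(`exists_automorphicRepData_detTwist_glOne`) is a cuspidal automorphic representation datum
`π_θ` of `GL_1(𝔸_K)` (on `GL(1)` the cuspidality condition is empty) such that
(i) `θ` is the Hecke character of `π_θ`: `r(g) φ - θ(det g) φ ∈ W' = ⊥` for all `φ ∈ W`
(`rightTranslation_detTwist_glOne`), and (ii) at all but finitely many finite places `w`
(off a level `𝔪` of `θ`, `HeckeCharacter.exists_level_glOne`), `π_θ` has Satake parameter
`{θ(ϖ_w)}` (`AutomorphicRepData.hasSatakeParamAt_detTwist_glOne`).  Borel–Jacquet 1979, 4.6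
(automorphic representations of `GL(1)` = idèle class characters); Tate 1950, §2.3. -/
theorem exists_cuspidal_glOne_heckeCharacter_hasSatakeParamAt
    (h1 : isCompact_glFiniteIntegralLevel 1 K) (θ : HeckeCharacter K) :
    ∃ τ : CuspidalAutomorphicRepData 1 K h1,
      (∀ (g : (AdelicGroupData.gl 1 K).Adelic), ∀ φ ∈ τ.1.W,
        rightTranslation (AdelicGroupData.gl 1 K) g φ -
          ((θ (Matrix.GeneralLinearGroup.det g) : ℂˣ) : ℂ) • φ ∈ τ.1.W') ∧
      ∀ᶠ w : HeightOneSpectrum (𝓞 K) in cofinite,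
        τ.1.HasSatakeParamAt w {θ.valueAtUniformizer w} := by
  obtain ⟨τ, hW, hW'⟩ := exists_automorphicRepData_detTwist_glOne h1 θ
  have hcusp : τ.W ≤ cuspFormsGL 1 K h1 := by
    rw [hW, Submodule.span_le]
    rintro _ rfl
    exact IsCuspFormGL.mem_cuspFormsGL
      ⟨isAutomorphicForm_detTwist_glOne h1 θ, fun k hk hk1 => absurd hk1 (by omega)⟩
  refine ⟨⟨τ, hcusp⟩, ?_, ?_⟩
  · -- (i) the Hecke character of `π_θ` is `θ`
    intro g φ hφ
    change φ ∈ τ.W at hφ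
    change _ ∈ τ.W'
    rw [hW] at hφ
    obtain ⟨a, rfl⟩ := Submodule.mem_span_singleton.1 hφ
    rw [hW', Submodule.mem_bot, map_smul, rightTranslation_detTwist_glOne, smul_comm, detTwist_apply',
      sub_self]
  · -- (ii) Satake parameters off a level of `θ`
    obtain ⟨𝔪, h𝔪, hθ𝔪⟩ := HeckeCharacter.exists_level_glOne θ
    filter_upwards [(Ideal.finite_factors h𝔪).compl_mem_cofinite] with w hw
    have h := AutomorphicRepData.hasSatakeParamAt_detTwist_glOne h1 hW hW' h𝔪 hθ𝔪 w hw
      (HeckeCharacter.valued_uniformizer (K := K) w)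
    simp only [HeckeCharacter.valueAtUniformizer, HeckeCharacter.localComponent_apply]
    exact h

/-- **A `GL₁` datum whose Hecke character has an infinity type is regular algebraic**
(Clozel's dictionary for `n = 1`: the algebraic automorphic representations of `GL(1)` are the
Hecke characters of type `A₀`).  By
`AutomorphicRepData.exists_hasInfinityType_of_hasInfinityType_heckeCharacter_glOne` the datum has a
well-formed infinity type `T` with `a`-multisets `{-n_ι}`; the `b`-exponent of the weight at `ι` is
the `a`-exponent at `ῑ` (well-formedness), so both lie in `ℤ = (1-1)/2 + ℤ`, and a singleton has no
repeated entry.  Clozel 1990, §1.1 and Déf. 1.8, 3.12 (`n = 1`); Weil 1956, §1.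
(Adapted from the crux line file `Cruxes/RegularAdjointLiftCM/Lines/nu-cubed-central-character.lean`,
`isRegularAlgebraic_glOne_of_hasInfinityType`.) -/
theorem isRegularAlgebraic_glOne_of_hasInfinityType {h1 : isCompact_glFiniteIntegralLevel 1 K}
    (ν : AutomorphicRepData (AutomorphyDatum.gl 1 K h1)) {θ : HeckeCharacter K}
    (hθ : ∀ (g : (AdelicGroupData.gl 1 K).Adelic), ∀ φ ∈ ν.W,
      rightTranslation (AdelicGroupData.gl 1 K) g φ -
        ((θ (Matrix.GeneralLinearGroup.det g) : ℂˣ) : ℂ) • φ ∈ ν.W')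
    {p q : NumberField.InfinitePlace K → ℤ} (hpq : θ.HasInfinityType p q) :
    ν.IsRegularAlgebraic := by
  obtain ⟨T, hT, ha⟩ := ν.exists_hasInfinityType_of_hasInfinityType_heckeCharacter_glOne hθ hpq
  refine ⟨T, hT, ?_, ?_⟩
  · intro ι P hP
    have haP : P.a ∈ (T ι).map ArchWeight.a := Multiset.mem_map_of_mem _ hP
    rw [ha ι, Multiset.mem_singleton] at haP
    have hsw : P.swap ∈ T (NumberField.ComplexEmbedding.conjugate ι) := by
      rw [hT.1.2 ι]
      exact Multiset.mem_map_of_mem _ hP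
    have hbP : P.swap.a ∈ (T (NumberField.ComplexEmbedding.conjugate ι)).map ArchWeight.a :=
      Multiset.mem_map_of_mem _ hsw
    rw [ha, Multiset.mem_singleton, ArchWeight.swap_a] at hbP
    refine ⟨-HeckeCharacter.embExponent p q ι,
      -HeckeCharacter.embExponent p q (NumberField.ComplexEmbedding.conjugate ι), ?_, ?_⟩
    · rw [haP]; push_cast; ring
    · rw [hbP]; push_cast; ring
  · intro ι
    rw [ha ι]
    exact Multiset.nodup_singleton _

/-- **An algebraic Hecke character as a regular algebraic cuspidal `GL(1)` datum with Satake
parameters `{θ(ϖ_w)}` almost everywhere** (`exists_cuspidal_glOne_heckeCharacter_hasSatakeParamAt`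
with `isRegularAlgebraic_glOne_of_hasInfinityType` and
`HeckeCharacter.isAlgebraic_iff_exists_hasInfinityType`).  Borel–Jacquet 1979, 4.6; Clozel 1990,
§1.1 (`n = 1`). -/
theorem exists_cuspidal_glOne_isRegularAlgebraic_of_isAlgebraic
    (h1 : isCompact_glFiniteIntegralLevel 1 K) {θ : HeckeCharacter K} (hθ : θ.IsAlgebraic) :
    ∃ τ : CuspidalAutomorphicRepData 1 K h1, τ.1.IsRegularAlgebraic ∧
      ∀ᶠ w : HeightOneSpectrum (𝓞 K) in cofinite,
        τ.1.HasSatakeParamAt w {θ.valueAtUniformizer w} := by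
  obtain ⟨τ, hτθ, hτsat⟩ := exists_cuspidal_glOne_heckeCharacter_hasSatakeParamAt h1 θ
  obtain ⟨p, q, hpq⟩ := (θ.isAlgebraic_iff_exists_hasInfinityType).1 hθ
  exact ⟨τ, isRegularAlgebraic_glOne_of_hasInfinityType τ.1 hτθ hpq, hτsat⟩

end Summit.Langlands.Langlands.Theorems.WeakAbelianSummandHecke

namespace Summit.Langlands.Langlands.Theorems

open Summit.Langlands.Langlands.Theses.IrreducibilityBySelfDuality

/-- **`WeakAbelianSummandHecke` holds** (item stmt-Langlands-13620 of route
`IrreducibilityBySelfDuality`; Böckle–Hui 2025, Thm. 1.1, cofinite special case, `GL(1)` language).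
A cofinite set of places has Dirichlet density one, so `ψ` weakly divides `ρ`
(`FramedGaloisRep.WeaklyDivides.of_eventually`); Böckle–Hui's theorem in the Hecke-character form
(`exists_heckeCharacter_of_weaklyDivides_holds`, proved in the tree) gives an algebraic Hecke
character `θ` with `charpoly ψ(Frob_v) = X - ι⁻¹(θ(ϖ_v))⁻¹` almost everywhere; its `GL(1)` datum
`π_θ` is cuspidal, regular algebraic, with Satake parameter `{θ(ϖ_v)}` almost everywhere
(`WeakAbelianSummandHecke.exists_cuspidal_glOne_isRegularAlgebraic_of_isAlgebraic`); and
`arithFrobPolyOfSatake ι q_v 1 {θ(ϖ_v)} = X - ι⁻¹(θ(ϖ_v))⁻¹` (`arithFrobPolyOfSatake_one`). -/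
theorem WeakAbelianSummandHecke_proof : WeakAbelianSummandHecke := by
  unfold WeakAbelianSummandHecke
  intro K _ _ h1 ℓ _ n E _ _ e ρ hss hrat ψ hψ ι
  have hwd : ψ.WeaklyDivides ρ := FramedGaloisRep.WeaklyDivides.of_eventually hψ
  obtain ⟨θ, hθalg, hθ⟩ :=
    exists_heckeCharacter_of_weaklyDivides_holds K ℓ n E e ρ hss hrat ψ hwd ι
  obtain ⟨τ, hτreg, hτsat⟩ :=
    WeakAbelianSummandHecke.exists_cuspidal_glOne_isRegularAlgebraic_of_isAlgebraic h1 hθalg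
  refine ⟨τ, hτreg, ?_⟩
  filter_upwards [hθ, hτsat] with v hv hsat
  refine ⟨θ.valueAtUniformizer v, hsat, hv.2.1, ?_⟩
  rw [arithFrobPolyOfSatake_one, Multiset.map_singleton, Multiset.prod_singleton]
  exact hv.2.2

end Summit.Langlands.Langlands.Theorems

end
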